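import Mathlib

/-!
# Beta / BoxPoincare — THE SHARP-ORDER DISCRETE POINCARÉ INEQUALITY ON A BOX `(Fin n)^ν`: the variance of a lattice function
# over a cubic block is `≤ ν·n(n−1)·(its in-block Dirichlet energy)` — the block-INTERNAL, component-wise inequality with a
# constant of order (block side)² that the k-UNIFORM multiscale coercivity of the multi-region averaged operator consumes
# (unit `b2b-balaban-beta-d4-p2`, GEN 7, MODEL crew; claim «MULTISCALE-POINCARE-MODEL» journal l.16779; part (A) of three)

HONEST FRAMING: discharging `BetaPertH` makes Bałaban's UV stability UNCONDITIONAL — NOT the continuum limit, NOT the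
Clay problem.  HONEST DEPENDENCY (verbatim): «continuum YM on T⁴ ⇐ BetaPertH ∧ nine spine estimates (0/9 proved);
BetaPertH ⇐ (D1) ∧ (D4) ∧ CAP+tail; G-an2-4 gates asym, D1 and NE2/3/4.»  THIS MODULE DISCHARGES NOTHING of `BetaPertH`,
asserts NOTHING printed and cites nothing as a fact (ABSOLUTE RULE): it is [folklore] lattice calculus (the canonical-path ∕
Cauchy–Schwarz proof of the discrete Poincaré inequality on a box, as in Diaconis–Stroock 1991 ∕ Saloff-Coste's lectures) about a
pure combinatorial object, the box `Fin ν → Fin n`; no operator of Bałaban's is instantiated.  WHY IT IS HERE (row D4, NODE O.2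
item (v) «k-UNIFORM constants», skeleton `beta/skeletons/D4-NODE-O2-b2b-balaban-beta-d4-p2.md` §2∕§8.2): the pv21 MODEL tower
(`Literature/…/B9Thm37GlueTorusCovTower`, honest scope (ii)) pays the in-block deviation with the comb constant `d(M−1)·M^d` per
block of side `M` and a `2^j` recursion over the levels, so its coercivity constant `σ_k` is NOT uniform in the number of levels;
the multiscale local coercivity of the multi-region averaged operator of [B9] = `Balaban1985BackgroundPropagators` (3.24) p. 394
SHAPE (parts (B)∕(C) of the claim) needs, per block of side `s`, a deviation constant of order `s²` — this file.  No class change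
on row D4 (critical-path width 0; D4 DISCHARGE NO DATE); NOT BetaPertH, NOT continuum, NOT Clay, NOT summit progress.

CONTENT (kernel, 0 sorry; `import Mathlib` only).  §1 the box `Box ν n = Fin ν → Fin n`, the in-box forward difference
`bd f v i` (zero on the far face), the in-box energy `energy f = Σ_v Σ_i (bd f v i)²`, the mean.  §2 ONE LINE: `(g b − g a)² ≤
(n−1)·Σ_t (D₁g t)²` (`line_sq_le`).  §3 COORDINATE PATHS: hybrid points `mixN m v w` (coordinates `< m` from `w`, the rest from
`v`) and **`pair_sq_le`**: `(f w − f v)² ≤ ν(n−1)·Σ_i Σ_t (bd f (update (mixN i v w) i t) i)²`.  §4 THE MULTIPLICITY, EXACTLY: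
`(v, w, t) ↦ update (mixN i v w) i t` is the first component of an explicit self-equivalence of `Box × Box × Fin n` (`legEquiv`),
hence **`sum_pairs_leg_eq`** `Σ_{v,w,t} G(update (mixN i v w) i t) = n^ν·n·Σ_z G z` (every in-box bond lies on exactly `n^{ν+1}`
coordinate paths).  §5 **`sum_pair_sq_le`** `Σ_{v,w} (f w − f v)² ≤ ν(n−1)·n^{ν+1}·energy f`; **`variance_le`** `Σ_v (f v − mean f)²
≤ ν·n·(n−1)·energy f`; the two-term form **`sum_sq_le_energy_add_mean`** `Σ_v (f v)² ≤ 2ν·n(n−1)·energy f + (2/n^ν)·(Σ_v f v)²`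
and its component form **`sum_sq_le_energy_add_mean_comp`** for `F : Box ν n → Cp → ℝ` — the shape parts (B)∕(C) consume.
-/

namespace Summit.QuantumFields.BalabanUV.Beta.BoxPoincare

open Finset Function

noncomputable section

variable {ν n : ℕ}

/-! ## §1 The box, the in-box forward difference, the energy, the mean -/

/-- The box of offsets `(Fin n)^ν`. [folklore] -/
abbrev Box (ν n : ℕ) : Type := Fin ν → Fin n

/-- The in-box forward difference of `f` at `v` in direction `i`: `f(v + e_i) − f(v)` if `v + e_i` is still in the box,
`0` on the far face. [folklore] -/
def bd (f : Box ν n → ℝ) (v : Box ν n) (i : Fin ν) : ℝ :=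
  if h : (v i : ℕ) + 1 < n then f (update v i ⟨(v i : ℕ) + 1, h⟩) - f v else 0

/-- The in-box Dirichlet energy `Σ_v Σ_i (bd f v i)²` (only bonds with both endpoints in the box). [folklore] -/
def energy (f : Box ν n → ℝ) : ℝ := ∑ v, ∑ i, bd f v i ^ 2

/-- The mean of `f` over the box, `(Σ_v f v)/n^ν`. [folklore] -/
def mean (f : Box ν n → ℝ) : ℝ := (∑ v, f v) / (n : ℝ) ^ ν

/-- The energy is a sum of squares, hence `≥ 0`. [folklore] -/
theorem energy_nonneg (f : Box ν n → ℝ) : 0 ≤ energy f :=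
  sum_nonneg fun _ _ => sum_nonneg fun _ _ => sq_nonneg _

/-- The box has `n^ν` points. [folklore] -/
theorem card_box : Fintype.card (Box ν n) = n ^ ν := by
  rw [Fintype.card_fun, Fintype.card_fin, Fintype.card_fin]

/-! ## §2 One line: telescoping and Cauchy–Schwarz along a coordinate axis -/

/-- The forward difference of a function on `Fin n` (zero at the last point). [folklore] -/
def lineD (g : Fin n → ℝ) (t : Fin n) : ℝ :=
  if h : (t : ℕ) + 1 < n then g ⟨(t : ℕ) + 1, h⟩ - g t else 0

/-- Extension of `g : Fin n → ℝ` to `ℕ` by `0`. [folklore] -/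
def extN (g : Fin n → ℝ) (s : ℕ) : ℝ := if h : s < n then g ⟨s, h⟩ else 0

/-- Inside the line the extension is `g`. [folklore] -/
theorem extN_of_lt (g : Fin n → ℝ) {s : ℕ} (h : s < n) : extN g s = g ⟨s, h⟩ := dif_pos h

/-- Telescoping along a line: for `a ≤ b` in `Fin n`, `g b − g a = Σ_{s ∈ [a,b)} (extN g (s+1) − extN g s)`. [folklore] -/
theorem sub_eq_sum_Ico (g : Fin n → ℝ) {a b : Fin n} (hab : (a : ℕ) ≤ b) :
    g b - g a = ∑ s ∈ Ico (a : ℕ) b, (extN g (s + 1) - extN g s) := by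
  have h := Finset.sum_range_sub (fun s => extN g ((a : ℕ) + s)) ((b : ℕ) - a)
  have hba : (a : ℕ) + ((b : ℕ) - a) = b := by omega
  simp only [add_zero] at h
  rw [hba, extN_of_lt g b.2, extN_of_lt g a.2] at h
  simp only [Fin.eta] at h
  rw [Finset.sum_Ico_eq_sum_range, ← h]
  refine Finset.sum_congr rfl fun s _ => ?_
  rw [show (a : ℕ) + (s + 1) = (a : ℕ) + s + 1 by ring]

/-- On `[a, b)` the ℕ-differences of the extension are the `Fin n`-differences `lineD`. [folklore] -/
theorem extN_sub_eq_lineD (g : Fin n → ℝ) {b : Fin n} {s : ℕ} (hs : s < (b : ℕ)) :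
    extN g (s + 1) - extN g s = lineD g ⟨s, lt_trans hs b.2⟩ := by
  have hs1 : s + 1 < n := lt_of_le_of_lt (Nat.succ_le_of_lt hs) b.2
  rw [extN_of_lt g hs1, extN_of_lt g (lt_trans hs b.2), lineD, dif_pos hs1]

/-- **One line.** `(g b − g a)² ≤ (n − 1)·Σ_t (lineD g t)²` for all `a b : Fin n` (telescoping + Cauchy–Schwarz; the sum
over the `|b − a| ≤ n − 1` steps between `a` and `b` is enlarged to all steps of the line). [folklore] -/
theorem line_sq_le (g : Fin n → ℝ) (a b : Fin n) :
    (g b - g a) ^ 2 ≤ ((n : ℝ) - 1) * ∑ t, lineD g t ^ 2 := by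
  -- reduce to `a ≤ b`
  wlog hab : (a : ℕ) ≤ b generalizing a b
  · have h := this b a (le_of_lt (not_le.mp hab))
    rwa [show (g a - g b) ^ 2 = (g b - g a) ^ 2 by ring] at h
  rw [sub_eq_sum_Ico g hab]
  -- Cauchy–Schwarz over the `b − a` steps
  have hcs := sq_sum_le_card_mul_sum_sq (s := Ico (a : ℕ) b) (f := fun s => extN g (s + 1) - extN g s)
  have hcard : ((Ico (a : ℕ) b).card : ℝ) ≤ (n : ℝ) - 1 := by
    rw [Nat.card_Ico]
    have hb := b.2
    have h1 : (1 : ℕ) ≤ n := by omega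
    calc (((b : ℕ) - a : ℕ) : ℝ) ≤ ((n - 1 : ℕ) : ℝ) := by exact_mod_cast (show ((b : ℕ) - a : ℕ) ≤ n - 1 by omega)
      _ = (n : ℝ) - 1 := by rw [Nat.cast_sub h1, Nat.cast_one]
  have hsum : ∑ s ∈ Ico (a : ℕ) b, (extN g (s + 1) - extN g s) ^ 2 ≤ ∑ t, lineD g t ^ 2 := by
    -- reindex the steps `s ∈ [a, b)` injectively into `Fin n`
    have hinj : ∀ s ∈ Ico (a : ℕ) b, s < n := fun s hs => lt_trans (Finset.mem_Ico.mp hs).2 b.2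
    calc ∑ s ∈ Ico (a : ℕ) b, (extN g (s + 1) - extN g s) ^ 2
        = ∑ s ∈ (Ico (a : ℕ) b).attach, lineD g ⟨s.1, hinj s.1 s.2⟩ ^ 2 := by
          rw [← Finset.sum_attach]
          refine Finset.sum_congr rfl fun s _ => ?_
          rw [extN_sub_eq_lineD g (Finset.mem_Ico.mp s.2).2]
      _ = ∑ t ∈ (Ico (a : ℕ) b).attach.image (fun s => (⟨s.1, hinj s.1 s.2⟩ : Fin n)), lineD g t ^ 2 := by
          rw [Finset.sum_image fun s _ s' _ h => Subtype.ext (by simpa using congrArg Fin.val h)]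
      _ ≤ ∑ t, lineD g t ^ 2 := Finset.sum_le_univ_sum_of_nonneg fun t => sq_nonneg _
  have hn : 0 ≤ (n : ℝ) - 1 := by
    have : (1 : ℝ) ≤ n := by exact_mod_cast (show (1 : ℕ) ≤ n by have := b.2; omega)
    linarith
  calc (∑ s ∈ Ico (a : ℕ) b, (extN g (s + 1) - extN g s)) ^ 2
      ≤ ((Ico (a : ℕ) b).card : ℝ) * ∑ s ∈ Ico (a : ℕ) b, (extN g (s + 1) - extN g s) ^ 2 := hcs
    _ ≤ ((n : ℝ) - 1) * ∑ t, lineD g t ^ 2 :=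
        mul_le_mul hcard hsum (sum_nonneg fun _ _ => sq_nonneg _) hn

/-! ## §3 Coordinate paths: hybrid points and the pair inequality -/

/-- The hybrid point after `m` legs of the coordinate path from `v` to `w`: coordinates `< m` already moved to `w`, the
others still at `v`. [folklore] -/
def mixN (m : ℕ) (v w : Box ν n) : Box ν n := fun j => if (j : ℕ) < m then w j else v j

/-- No leg moved: the start point. [folklore] -/
theorem mixN_zero (v w : Box ν n) : mixN 0 v w = v := by funext j; simp [mixN]

/-- All `ν` legs moved: the end point. [folklore] -/
theorem mixN_all (v w : Box ν n) : mixN ν v w = w := by funext j; simp [mixN, j.2]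

/-- The `m`-th hybrid point still has its `m`-th coordinate at `v`. [folklore] -/
theorem mixN_apply_self (i : Fin ν) (v w : Box ν n) : mixN i v w i = v i := by
  simp [mixN]

/-- One more leg = updating coordinate `m` to its final value. [folklore] -/
theorem mixN_succ (i : Fin ν) (v w : Box ν n) : mixN ((i : ℕ) + 1) v w = update (mixN i v w) i (w i) := by
  funext j
  by_cases hji : j = i
  · subst hji; simp [mixN]
  · rw [update_of_ne hji]
    have hne : (j : ℕ) ≠ i := fun h => hji (Fin.ext h)
    simp only [mixN]
    by_cases h1 : (j : ℕ) < i
    · rw [if_pos h1, if_pos (by omega)]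
    · rw [if_neg h1, if_neg (by omega)]

/-- The in-box difference at a point of the line through `z` in direction `i` is the line difference of the restriction
`t ↦ f (update z i t)`. [folklore] -/
theorem bd_update_eq_lineD (f : Box ν n → ℝ) (z : Box ν n) (i : Fin ν) (t : Fin n) :
    bd f (update z i t) i = lineD (fun s => f (update z i s)) t := by
  simp only [bd, lineD, update_self, update_idem]

/-- **The pair inequality.** `(f w − f v)² ≤ ν·(n−1)·Σ_i Σ_t (bd f (update (mixN i v w) i t) i)²`: telescope `f w − f v` over
the `ν` axis-parallel legs of the coordinate path (Cauchy–Schwarz, factor `ν`), and bound each leg by the whole line through it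
(`line_sq_le`, factor `n − 1`). [folklore] -/
theorem pair_sq_le (f : Box ν n → ℝ) (v w : Box ν n) :
    (f w - f v) ^ 2 ≤ (ν : ℝ) * ((n : ℝ) - 1) * ∑ i : Fin ν, ∑ t : Fin n, bd f (update (mixN i v w) i t) i ^ 2 := by
  have htel : f w - f v = ∑ m ∈ range ν, (f (mixN (m + 1) v w) - f (mixN m v w)) := by
    rw [Finset.sum_range_sub (fun m => f (mixN m v w)), mixN_all, mixN_zero]
  have hcs := sq_sum_le_card_mul_sum_sq (s := range ν) (f := fun m => f (mixN (m + 1) v w) - f (mixN m v w))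
  rw [Finset.card_range] at hcs
  have hleg : ∀ i : Fin ν, (f (mixN ((i : ℕ) + 1) v w) - f (mixN i v w)) ^ 2 ≤
      ((n : ℝ) - 1) * ∑ t : Fin n, bd f (update (mixN i v w) i t) i ^ 2 := by
    intro i
    have h := line_sq_le (fun s => f (update (mixN i v w) i s)) (v i) (w i)
    rw [← mixN_succ, ← mixN_apply_self i v w, update_eq_self] at h
    exact h.trans (le_of_eq (by simp_rw [bd_update_eq_lineD]))
  have hlegs : ∑ m ∈ range ν, (f (mixN (m + 1) v w) - f (mixN m v w)) ^ 2 ≤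
      ((n : ℝ) - 1) * ∑ i : Fin ν, ∑ t : Fin n, bd f (update (mixN i v w) i t) i ^ 2 := by
    rw [Finset.sum_range (fun m => (f (mixN (m + 1) v w) - f (mixN m v w)) ^ 2), Finset.mul_sum]
    exact Finset.sum_le_sum fun i _ => hleg i
  calc (f w - f v) ^ 2 = (∑ m ∈ range ν, (f (mixN (m + 1) v w) - f (mixN m v w))) ^ 2 := by rw [htel]
    _ ≤ (ν : ℝ) * ∑ m ∈ range ν, (f (mixN (m + 1) v w) - f (mixN m v w)) ^ 2 := hcs
    _ ≤ (ν : ℝ) * (((n : ℝ) - 1) * ∑ i : Fin ν, ∑ t : Fin n, bd f (update (mixN i v w) i t) i ^ 2) :=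
        mul_le_mul_of_nonneg_left hlegs (Nat.cast_nonneg ν)
    _ = (ν : ℝ) * ((n : ℝ) - 1) * ∑ i : Fin ν, ∑ t : Fin n, bd f (update (mixN i v w) i t) i ^ 2 := by ring

/-! ## §4 The multiplicity, exactly: every in-box bond lies on `n^{ν+1}` coordinate paths -/

/-- The point of the `i`-th leg of the path from `v` to `w` with `i`-th coordinate `t`. [folklore] -/
def legPt (i : Fin ν) (x : Box ν n × Box ν n × Fin n) : Box ν n := update (mixN i x.1 x.2.1) i x.2.2

/-- Forward map of the leg equivalence: `(v, w, t) ↦ (leg point, the unused coordinates (v_{<i}, w_{≥i}), v_i)`. [folklore] -/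
def legFwd (i : Fin ν) (x : Box ν n × Box ν n × Fin n) : Box ν n × Box ν n × Fin n :=
  (legPt i x, fun j => if (j : ℕ) < i then x.1 j else x.2.1 j, x.1 i)

/-- Backward map of the leg equivalence. [folklore] -/
def legBwd (i : Fin ν) (y : Box ν n × Box ν n × Fin n) : Box ν n × Box ν n × Fin n :=
  (fun j => if (j : ℕ) < i then y.2.1 j else if j = i then y.2.2 else y.1 j,
   fun j => if (j : ℕ) < i then y.1 j else y.2.1 j, y.1 i)

/-- `legBwd` is a left inverse of `legFwd`. [folklore] -/
theorem legBwd_legFwd (i : Fin ν) (x : Box ν n × Box ν n × Fin n) : legBwd i (legFwd i x) = x := by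
  obtain ⟨v, w, t⟩ := x
  simp only [legFwd, legBwd, legPt, Prod.mk.injEq]
  refine ⟨?_, ?_, ?_⟩
  · funext j
    by_cases hj : (j : ℕ) < i
    · simp [hj]
    · by_cases hji : j = i
      · subst hji; simp
      · rw [if_neg hj, if_neg hji, update_of_ne hji]
        simp [mixN, hj]
  · funext j
    by_cases hj : (j : ℕ) < i
    · have hji : j ≠ i := fun h => by subst h; exact lt_irrefl _ hj
      rw [if_pos hj, update_of_ne hji]
      simp [mixN, hj]
    · simp [hj]
  · simp

/-- `legBwd` is a right inverse of `legFwd`. [folklore] -/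
theorem legFwd_legBwd (i : Fin ν) (y : Box ν n × Box ν n × Fin n) : legFwd i (legBwd i y) = y := by
  obtain ⟨z, u, s⟩ := y
  simp only [legFwd, legBwd, legPt, Prod.mk.injEq]
  refine ⟨?_, ?_, ?_⟩
  · funext j
    by_cases hji : j = i
    · subst hji; simp
    · rw [update_of_ne hji]
      by_cases hj : (j : ℕ) < i
      · simp [mixN, hj]
      · simp [mixN, hj, hji]
  · funext j
    by_cases hj : (j : ℕ) < i <;> simp [hj]
  · simp

/-- **The leg equivalence** of `Box × Box × Fin n` whose first component is the leg point. [folklore] -/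
def legEquiv (i : Fin ν) : (Box ν n × Box ν n × Fin n) ≃ (Box ν n × Box ν n × Fin n) where
  toFun := legFwd i
  invFun := legBwd i
  left_inv := legBwd_legFwd i
  right_inv := legFwd_legBwd i

/-- **Exact multiplicity.** `Σ_v Σ_w Σ_t G(update (mixN i v w) i t) = n^ν·n·Σ_z G z`: along the leg equivalence the sum
over `(v, w, t)` becomes `Σ_{(z,u,s)} G z`. [folklore] -/
theorem sum_pairs_leg_eq (i : Fin ν) (G : Box ν n → ℝ) :
    ∑ v : Box ν n, ∑ w : Box ν n, ∑ t : Fin n, G (update (mixN i v w) i t) =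
      ((n : ℝ) ^ ν * n) * ∑ z : Box ν n, G z := by
  have h1 : ∑ x : Box ν n × Box ν n × Fin n, G (legPt i x) =
      ∑ v : Box ν n, ∑ w : Box ν n, ∑ t : Fin n, G (update (mixN i v w) i t) := by
    simp only [Fintype.sum_prod_type, legPt]
  rw [← h1, Fintype.sum_equiv (legEquiv i) (fun x => G (legPt i x)) (fun y => G y.1) (fun x => rfl)]
  rw [Fintype.sum_prod_type, Finset.mul_sum]
  refine Finset.sum_congr rfl fun z _ => ?_
  dsimp only
  rw [Finset.sum_const, Finset.card_univ, nsmul_eq_mul, Fintype.card_prod, card_box, Fintype.card_fin]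
  push_cast
  ring

/-! ## §5 The inequalities -/

/-- **Sum over pairs.** `Σ_{v,w} (f w − f v)² ≤ ν(n−1)·(n^ν·n)·energy f`. [folklore] -/
theorem sum_pair_sq_le (f : Box ν n → ℝ) :
    ∑ v : Box ν n, ∑ w : Box ν n, (f w - f v) ^ 2 ≤
      (ν : ℝ) * ((n : ℝ) - 1) * ((n : ℝ) ^ ν * n) * energy f := by
  have hkey : ∀ i : Fin ν, ∑ v : Box ν n, ∑ w : Box ν n, ∑ t : Fin n, bd f (update (mixN i v w) i t) i ^ 2 =
      ((n : ℝ) ^ ν * n) * ∑ z : Box ν n, bd f z i ^ 2 :=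
    fun i => sum_pairs_leg_eq i (fun z => bd f z i ^ 2)
  have hswap : ∑ v : Box ν n, ∑ w : Box ν n, ∑ i : Fin ν, ∑ t : Fin n, bd f (update (mixN i v w) i t) i ^ 2 =
      ∑ i : Fin ν, ∑ v : Box ν n, ∑ w : Box ν n, ∑ t : Fin n, bd f (update (mixN i v w) i t) i ^ 2 :=
    calc ∑ v : Box ν n, ∑ w : Box ν n, ∑ i : Fin ν, ∑ t : Fin n, bd f (update (mixN i v w) i t) i ^ 2
        = ∑ v : Box ν n, ∑ i : Fin ν, ∑ w : Box ν n, ∑ t : Fin n, bd f (update (mixN i v w) i t) i ^ 2 :=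
          Finset.sum_congr rfl fun v _ => Finset.sum_comm
      _ = ∑ i : Fin ν, ∑ v : Box ν n, ∑ w : Box ν n, ∑ t : Fin n, bd f (update (mixN i v w) i t) i ^ 2 :=
          Finset.sum_comm
  calc ∑ v : Box ν n, ∑ w : Box ν n, (f w - f v) ^ 2
      ≤ ∑ v : Box ν n, ∑ w : Box ν n,
          (ν : ℝ) * ((n : ℝ) - 1) * ∑ i : Fin ν, ∑ t : Fin n, bd f (update (mixN i v w) i t) i ^ 2 :=
        Finset.sum_le_sum fun v _ => Finset.sum_le_sum fun w _ => pair_sq_le f v w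
    _ = (ν : ℝ) * ((n : ℝ) - 1) *
          ∑ v : Box ν n, ∑ w : Box ν n, ∑ i : Fin ν, ∑ t : Fin n, bd f (update (mixN i v w) i t) i ^ 2 := by
        simp only [Finset.mul_sum]
    _ = (ν : ℝ) * ((n : ℝ) - 1) *
          ∑ i : Fin ν, ∑ v : Box ν n, ∑ w : Box ν n, ∑ t : Fin n, bd f (update (mixN i v w) i t) i ^ 2 := by
        rw [hswap]
    _ = (ν : ℝ) * ((n : ℝ) - 1) * ∑ i : Fin ν, ((n : ℝ) ^ ν * n) * ∑ z : Box ν n, bd f z i ^ 2 := by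
        congr 1
        exact Finset.sum_congr rfl fun i _ => hkey i
    _ = (ν : ℝ) * ((n : ℝ) - 1) * ((n : ℝ) ^ ν * n) * energy f := by
        rw [← Finset.mul_sum, energy, Finset.sum_comm]
        ring

/-- The variance is controlled by the sum over pairs: `Σ_v (f v − mean f)² ≤ n^{−ν}·Σ_{v,w} (f w − f v)²` (Cauchy–Schwarz on
`f v − mean f = n^{−ν}Σ_w (f v − f w)`). [folklore] -/
theorem variance_le_sum_pair (f : Box ν n → ℝ) :
    ∑ v, (f v - mean f) ^ 2 ≤ ((n : ℝ) ^ ν)⁻¹ * ∑ v : Box ν n, ∑ w : Box ν n, (f w - f v) ^ 2 := by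
  by_cases hN : (n : ℝ) ^ ν = 0
  · -- then the box is empty: both sides vanish
    have hn : n = 0 := by
      rcases pow_eq_zero_iff'.mp hN with ⟨h0, _⟩
      exact_mod_cast h0
    have hν : ν ≠ 0 := by
      rintro rfl
      simp at hN
    haveI : IsEmpty (Box ν n) := by
      subst hn
      obtain ⟨k, hk⟩ := Nat.exists_eq_succ_of_ne_zero hν
      exact ⟨fun v => Fin.elim0 (v ⟨0, by omega⟩)⟩
    simp
  have hNpos : 0 < (n : ℝ) ^ ν := lt_of_le_of_ne (pow_nonneg (Nat.cast_nonneg n) ν) (Ne.symm hN)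
  have hcardR : ((Finset.univ : Finset (Box ν n)).card : ℝ) = (n : ℝ) ^ ν := by
    rw [Finset.card_univ, card_box]; push_cast; ring
  rw [Finset.mul_sum]
  refine Finset.sum_le_sum fun v _ => ?_
  have hrepr : f v - mean f = ((n : ℝ) ^ ν)⁻¹ * ∑ w : Box ν n, (f v - f w) := by
    rw [Finset.sum_sub_distrib, Finset.sum_const, nsmul_eq_mul, hcardR, mean]
    field_simp
  have hcs := sq_sum_le_card_mul_sum_sq (s := (Finset.univ : Finset (Box ν n))) (f := fun w => f v - f w)
  rw [hcardR] at hcs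
  rw [hrepr, mul_pow]
  calc (((n : ℝ) ^ ν)⁻¹) ^ 2 * (∑ w : Box ν n, (f v - f w)) ^ 2
      ≤ (((n : ℝ) ^ ν)⁻¹) ^ 2 * ((n : ℝ) ^ ν * ∑ w : Box ν n, (f v - f w) ^ 2) :=
        mul_le_mul_of_nonneg_left hcs (sq_nonneg _)
    _ = ((n : ℝ) ^ ν)⁻¹ * ∑ w : Box ν n, (f w - f v) ^ 2 := by
        have : ∑ w : Box ν n, (f v - f w) ^ 2 = ∑ w : Box ν n, (f w - f v) ^ 2 :=
          Finset.sum_congr rfl fun w _ => by ring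
        rw [this]
        field_simp

/-- **THE SHARP-ORDER BOX POINCARÉ INEQUALITY.** For every `f : (Fin n)^ν → ℝ`:
`Σ_v (f v − mean f)² ≤ ν·n·(n−1)·energy f` — deviation constant of order (side)², uniformly in the dimension up to the
factor `ν`, from in-box bonds only. [folklore] -/
theorem variance_le (f : Box ν n → ℝ) :
    ∑ v, (f v - mean f) ^ 2 ≤ (ν : ℝ) * n * ((n : ℝ) - 1) * energy f := by
  refine (variance_le_sum_pair f).trans ?_
  by_cases hN : (n : ℝ) ^ ν = 0
  · have hn : (n : ℝ) = 0 := by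
      rcases pow_eq_zero_iff'.mp hN with ⟨h0, _⟩
      exact h0
    rw [hN, hn]
    simp
  calc ((n : ℝ) ^ ν)⁻¹ * ∑ v : Box ν n, ∑ w : Box ν n, (f w - f v) ^ 2
      ≤ ((n : ℝ) ^ ν)⁻¹ * ((ν : ℝ) * ((n : ℝ) - 1) * ((n : ℝ) ^ ν * n) * energy f) :=
        mul_le_mul_of_nonneg_left (sum_pair_sq_le f) (inv_nonneg.mpr (pow_nonneg (Nat.cast_nonneg n) ν))
    _ = (ν : ℝ) * n * ((n : ℝ) - 1) * energy f := by
        field_simp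

/-- **The two-term coercivity form.** `Σ_v (f v)² ≤ 2ν·n(n−1)·energy f + (2/n^ν)·(Σ_v f v)²` — the shape in which a block's
mass is paid by its in-block energy and its (averaging-term) mean. [folklore] -/
theorem sum_sq_le_energy_add_mean (f : Box ν n → ℝ) :
    ∑ v, f v ^ 2 ≤ 2 * ((ν : ℝ) * n * ((n : ℝ) - 1)) * energy f + 2 / (n : ℝ) ^ ν * (∑ v, f v) ^ 2 := by
  by_cases hN : (n : ℝ) ^ ν = 0
  · have hn : n = 0 := by
      rcases pow_eq_zero_iff'.mp hN with ⟨h0, _⟩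
      exact_mod_cast h0
    have hν : ν ≠ 0 := by
      rintro rfl
      simp at hN
    haveI : IsEmpty (Box ν n) := by
      subst hn
      obtain ⟨k, hk⟩ := Nat.exists_eq_succ_of_ne_zero hν
      exact ⟨fun v => Fin.elim0 (v ⟨0, by omega⟩)⟩
    simp [energy]
  have hcardR : ((Finset.univ : Finset (Box ν n)).card : ℝ) = (n : ℝ) ^ ν := by
    rw [Finset.card_univ, card_box]; push_cast; ring
  -- `f v = (f v − mean) + mean`, `(a+b)² ≤ 2a² + 2b²`
  have hpt : ∀ v : Box ν n, f v ^ 2 ≤ 2 * (f v - mean f) ^ 2 + 2 * mean f ^ 2 := by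
    intro v
    nlinarith [sq_nonneg (f v - mean f - mean f)]
  have hmean : ((n : ℝ) ^ ν) * mean f ^ 2 = ((n : ℝ) ^ ν)⁻¹ * (∑ v, f v) ^ 2 := by
    rw [mean]; field_simp
  calc ∑ v, f v ^ 2 ≤ ∑ v : Box ν n, (2 * (f v - mean f) ^ 2 + 2 * mean f ^ 2) := Finset.sum_le_sum fun v _ => hpt v
    _ = 2 * ∑ v : Box ν n, (f v - mean f) ^ 2 + 2 * (((n : ℝ) ^ ν) * mean f ^ 2) := by
        rw [Finset.sum_add_distrib, ← Finset.mul_sum, Finset.sum_const, nsmul_eq_mul, hcardR]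
        ring
    _ ≤ 2 * ((ν : ℝ) * n * ((n : ℝ) - 1) * energy f) + 2 * (((n : ℝ) ^ ν)⁻¹ * (∑ v, f v) ^ 2) := by
        rw [hmean]
        have := variance_le f
        linarith
    _ = 2 * ((ν : ℝ) * n * ((n : ℝ) - 1)) * energy f + 2 / (n : ℝ) ^ ν * (∑ v, f v) ^ 2 := by ring

/-! ### The component form -/

/-- **The component form** for a `Cp`-valued field `F : (Fin n)^ν → Cp → ℝ`: summing the scalar two-term inequality over the
components, `Σ_v Σ_j F v j² ≤ 2ν·n(n−1)·Σ_j energy (F · j) + (2/n^ν)·Σ_j (Σ_v F v j)²`. [folklore] -/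
theorem sum_sq_le_energy_add_mean_comp {Cp : Type*} [Fintype Cp] (F : Box ν n → Cp → ℝ) :
    ∑ v, ∑ j, F v j ^ 2 ≤
      2 * ((ν : ℝ) * n * ((n : ℝ) - 1)) * ∑ j, energy (fun v => F v j) + 2 / (n : ℝ) ^ ν * ∑ j, (∑ v, F v j) ^ 2 := by
  rw [Finset.sum_comm, Finset.mul_sum, Finset.mul_sum, ← Finset.sum_add_distrib]
  exact Finset.sum_le_sum fun j _ => sum_sq_le_energy_add_mean (fun v => F v j)

end

end Summit.QuantumFields.BalabanUV.Beta.BoxPoincare
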